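import Mathlib.RingTheory.Coprime.Lemmas
import Mathlib.Data.Int.GCD
import Mathlib.Tactic.Ring
import Mathlib.Tactic.Linarith
import Mathlib.Tactic.NormNum
import Mathlib.Tactic.LinearCombination
import HarnessLib

/-!
# Venture HSemireg — LEMMA ∥'s lattice step (ENGINE-W PROBE5 §13 ∕ §14 ∕ §23): two PARALLEL vectors of `ℤ²` are integer multiples of ONE
# vector with COPRIME multipliers — «p·q̄ ∈ ℚ ⟹ p = r·w, q = s·w with r, s ∈ ℤ coprime and w ∈ O_K» for `O_K = ℤ[ω] ≅ ℤ²` — kernel arithmetic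

HONEST FRAMING. Lean index of the computation cell `pub-hsemireg`, widening group ENGINE-W (code A, seat `engine-w-1`, gen 18).
ELEMENTARY `gcd` ARITHMETIC IN `ℤ²` ONLY; no number field, lattice `I₁`, abelian variety, sheaf or semiregularity map is constructed; nothing here says
that HC, HC_CM or HC_AV holds. Theorems only (0 `def`, 0 named fact, 0 `sorry`). New namespace `ParallelVectors`. Companion:
`R1DiophantinePellTwo.lean` (#31: `alpha_tau_alpha` — the identity producing the relation `q·p̄ = p·q̄`, and `last_step`).

SOURCE (the cell's own result, by value): `widen/ENGINE-W/out/probe5/PROBE5-STIZ-A.md` §13 LEMMA ∥ («write α₀ = p + q·l (p, q ∈ O_K); … q·p̄ =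
p·q̄, i.e. p·q̄ ∈ ℚ: p = r·w, q = s·w with r, s ∈ ℤ coprime and w ∈ O_K (w := xp + yq for xr + ys = 1)») and §23 LEMMA ∥ (as §13, restated) («p q̄ = q p̄
⟺ p q̄ ∈ ℚ … ⟺ p, q are ℚ-proportional to a common w ∈ K»). In coordinates `p = a + bω`, `q = c + dω` the condition «`p q̄ ∈ ℚ`» is `a·d = b·c`
(the `ω`-coefficient of `p q̄` is `±(bc − ad)`), and the conclusion is about the integer vectors `(a,b)`, `(c,d)`. What the kernel holds:

* `omega_coeff` — for `ω² = −ω − 1` (`ω̄ = −1 − ω`): `(a + bω)(c + dω̄) = (ac + bd − ad) + (bc − ad)·ω`, so «`p q̄ ∈ ℤ`» ⟺ `ad = bc` (`ring`, with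
  `ω` a symbol in any commutative ring satisfying `ω² + ω + 1 = 0`).
* **`parallel_vectors`** — `a·d = b·c` ⟹ `∃ u v r s, IsCoprime r s ∧ (a, b) = r·(u, v) ∧ (c, d) = s·(u, v)`.
  PROOF (kernel): if `(a,b) = 0` take `w = (c,d)`, `(r,s) = (0,1)`; else `(a,b) = g·(a₀,b₀)` with `a₀, b₀` coprime, `a₀ d = b₀ c` forces
  `(c,d) = λ·(a₀,b₀)`, and dividing `(g, λ)` by their gcd `e` gives coprime `(r, s)` with `w = e·(a₀, b₀)`.
* `bezout_w` — the printed recipe: if `x·r + y·s = 1`, `p = r·w`, `q = s·w` (componentwise) then `w = x·p + y·q`.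
-/

namespace Summit.Ventures.HSemireg.ParallelVectors

/-- **The `ω`-coefficient of `p·q̄`**: with `ω² + ω + 1 = 0` and `q̄ = c + d·ω̄ = c + d(−1 − ω)`,
`(a + bω)(c + d(−1−ω)) = (ac − ad + bd) + (bc − ad)·ω`. [kernel, `ring` modulo the relation] -/
theorem omega_coeff {R : Type*} [CommRing R] (ω a b c d : R) (hω : ω ^ 2 = -ω - 1) :
    (a + b * ω) * (c + d * (-1 - ω)) = (a * c - a * d + b * d) + (b * c - a * d) * ω := by
  linear_combination (-(b * d)) * hω

/-- **Parallel integer vectors share a primitive direction with coprime multipliers**: if `a·d = b·c` then there are `u v r s : ℤ` with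
`r, s` coprime, `(a, b) = (r·u, r·v)` and `(c, d) = (s·u, s·v)`. [kernel] -/
theorem parallel_vectors {a b c d : ℤ} (h : a * d = b * c) :
    ∃ u v r s : ℤ, IsCoprime r s ∧ a = r * u ∧ b = r * v ∧ c = s * u ∧ d = s * v := by
  by_cases hab : a = 0 ∧ b = 0
  · obtain ⟨rfl, rfl⟩ := hab
    exact ⟨c, d, 0, 1, isCoprime_one_right, by ring, by ring, by ring, by ring⟩
  · -- (a,b) ≠ 0: extract the primitive vector (a₀,b₀)
    have hg : 0 < Int.gcd a b := by
      rcases Nat.eq_zero_or_pos (Int.gcd a b) with h0 | h0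
      · exact absurd (Int.gcd_eq_zero_iff.1 h0) hab
      · exact h0
    obtain ⟨g, a₀, b₀, hg0, hcop, ha, hb⟩ := Int.exists_gcd_one' hg
    have hcop' : IsCoprime a₀ b₀ := Int.isCoprime_iff_gcd_eq_one.2 hcop
    -- a₀ d = b₀ c
    have hrel : a₀ * d = b₀ * c := by
      have : (g : ℤ) * (a₀ * d) = (g : ℤ) * (b₀ * c) := by
        calc (g : ℤ) * (a₀ * d) = (a₀ * g) * d := by ring
          _ = a * d := by rw [ha]
          _ = b * c := h
          _ = (b₀ * g) * c := by rw [hb]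
          _ = (g : ℤ) * (b₀ * c) := by ring
      have hgne : (g : ℤ) ≠ 0 := by exact_mod_cast hg0.ne'
      exact mul_left_cancel₀ hgne this
    -- c = μ a₀ and d = μ b₀ for one μ
    obtain ⟨μ, hc, hd⟩ : ∃ μ : ℤ, c = μ * a₀ ∧ d = μ * b₀ := by
      -- a₀ ∣ b₀ c with a₀ ⊥ b₀ ⇒ a₀ ∣ c
      have hdvd : a₀ ∣ c := by
        have : a₀ ∣ b₀ * c := ⟨d, by linarith⟩
        exact hcop'.dvd_of_dvd_mul_left this
      obtain ⟨μ, hμ⟩ := hdvd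
      by_cases ha0 : a₀ = 0
      · -- then b₀ is a unit and c = 0
        subst ha0
        have hb0 : IsUnit b₀ := isCoprime_zero_left.1 hcop'
        rcases Int.isUnit_iff.1 hb0 with hb1 | hb1
        · refine ⟨d, ?_, ?_⟩
          · simp at hμ; rw [hμ]; ring
          · rw [hb1]; ring
        · refine ⟨-d, ?_, ?_⟩
          · simp at hμ; rw [hμ]; ring
          · rw [hb1]; ring
      · refine ⟨μ, by rw [hμ]; ring, ?_⟩
        have : a₀ * d = a₀ * (μ * b₀) := by rw [hrel, hμ]; ring
        exact mul_left_cancel₀ ha0 this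
    -- divide (g, μ) by e = gcd(g, μ) > 0
    have he : 0 < Int.gcd (g : ℤ) μ := by
      apply Nat.pos_of_ne_zero
      intro h0
      have := (Int.gcd_eq_zero_iff.1 h0).1
      have : (g : ℤ) ≠ 0 := by exact_mod_cast hg0.ne'
      contradiction
    obtain ⟨e, r, s, he0, hrs, hgr, hμs⟩ := Int.exists_gcd_one' he
    refine ⟨(e : ℤ) * a₀, (e : ℤ) * b₀, r, s, Int.isCoprime_iff_gcd_eq_one.2 hrs, ?_, ?_, ?_, ?_⟩
    · rw [ha, hgr]; ring
    · rw [hb, hgr]; ring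
    · rw [hc, hμs]; ring
    · rw [hd, hμs]; ring

/-- **The printed recipe for `w`**: if `x·r + y·s = 1` and `p = r·w`, `q = s·w` then `w = x·p + y·q` (one coordinate at a time). [kernel, `ring`] -/
theorem bezout_w (x y r s w : ℤ) (h : x * r + y * s = 1) : x * (r * w) + y * (s * w) = w := by
  linear_combination w * h

/-- Conversely multiples of one vector are parallel: `(r·u)(s·v) = (r·v)(s·u)`. [kernel, `ring`] -/
theorem multiples_parallel (u v r s : ℤ) : (r * u) * (s * v) = (r * v) * (s * u) := by
  ring

end Summit.Ventures.HSemireg.ParallelVectors
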